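import Literature.NumberTheory.LFunctions.Zhang2022.Section3Lemma31
import HarnessLib

/-!
# The smoothed logarithmic divisor sum on a window: `W_d(B) − W_d(A) ≪ (1 + log B) log(B/A)`

Topic `Literature/NumberTheory/LFunctions`. Everything here is PROVED.

For `W_d(Y) = Σ_{n ≥ 1} d(n) n^{-1} e^{-n/Y}` (the tree's `DivisorSumCharSq.W dCoeff Y`) and
`1 ≤ A`, `4A ≤ B` we prove `‖W_d(B) − W_d(A)‖ ≤ C (1 + log B) log(B/A)` (`C = 12`). This is the
elementary main-term input of Conrey–Iwaniec's (6.48)/(6.49) ("`∫ g(y)(α log y + β) dy/y`", the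
`α log y` part): with `w(n) = e^{-n/B} − e^{-n/A}` one has `W_d(B) − W_d(A) = Σ_{a,b ≥ 1} w(ab)/(ab)`,
the inner sum `Σ_b w(ab)/b` is `≤ 4 + log(B/A)` for `a ≤ B` (ranges `b ≤ A/a`, where `w(ab) ≤ ab/A`;
`A/a < b ≤ B/a`, a harmonic window; `b > B/a`, a geometric tail) and `≤ 2e^{-a/B}` for `a > B`, and
`Σ_a e^{-a/B}/a ≤ log(1 + B)`. Stub S1 of SKELETON I6c (line `smoothed-mellin-large`, cell
landau-siegel/ls-inputs).

## References
* [ConreyIwaniec2002] B. Conrey, H. Iwaniec, Acta Arith. 103 (2002) 259–312, §6 (6.46)–(6.49).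
-/

noncomputable section

open Complex Filter Topology Set Real Finset

namespace Literature.NumberTheory.LFunctions.DivisorSumCharSq

open Literature.NumberTheory.LFunctions.ZetaM4 (dCoeff dCoeff_apply)
open Literature.NumberTheory.LFunctions.Zhang2022.Lemma31 (W_ofReal summable_mul_exp_div Shalf
  hasSum_exp_div Shalf_le exp_le_exp_half W_dCoeff_im)

/-! ### §1. The weight `w(x) = e^{-x/B} − e^{-x/A}` -/

section Weight

variable {A B : ℝ}

/-- `0 ≤ e^{-x/B} − e^{-x/A}` for `0 < A ≤ B`, `x ≥ 0`. [folklore] -/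
private theorem w_nonneg (hA : 0 < A) (hAB : A ≤ B) {x : ℝ} (hx : 0 ≤ x) :
    0 ≤ Real.exp (-(x / B)) - Real.exp (-(x / A)) := by
  have : Real.exp (-(x / A)) ≤ Real.exp (-(x / B)) := by
    rw [Real.exp_le_exp, neg_le_neg_iff]
    exact div_le_div_of_nonneg_left hx hA hAB
  linarith

/-- `e^{-x/B} − e^{-x/A} ≤ x/A` for `A, B > 0`, `x ≥ 0` (`1 − e^{-u} ≤ u`). [folklore] -/
private theorem w_le_div (hB : 0 < B) {x : ℝ} (hx : 0 ≤ x) :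
    Real.exp (-(x / B)) - Real.exp (-(x / A)) ≤ x / A := by
  have h1 : Real.exp (-(x / B)) ≤ 1 := Real.exp_le_one_iff.2 (neg_nonpos.2 (div_nonneg hx hB.le))
  have h2 : 1 - x / A ≤ Real.exp (-(x / A)) := by
    have := Real.add_one_le_exp (-(x / A)); linarith
  linarith

/-- `e^{-x/B} − e^{-x/A} ≤ e^{-x/B}`. [folklore] -/
private theorem w_le_exp {x : ℝ} :
    Real.exp (-(x / B)) - Real.exp (-(x / A)) ≤ Real.exp (-(x / B)) := by
  linarith [Real.exp_pos (-(x / A))]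

/-- `e^{-x/B} − e^{-x/A} ≤ 1` for `x ≥ 0`, `B > 0`. [folklore] -/
private theorem w_le_one (hB : 0 < B) {x : ℝ} (hx : 0 ≤ x) :
    Real.exp (-(x / B)) - Real.exp (-(x / A)) ≤ 1 := by
  have h1 : Real.exp (-(x / B)) ≤ 1 := Real.exp_le_one_iff.2 (neg_nonpos.2 (div_nonneg hx hB.le))
  linarith [Real.exp_pos (-(x / A))]

end Weight

/-! ### §2. A harmonic window and two geometric tails -/

section Harmonic

/-- `Σ_{b ∈ (m, M]} 1/b = H_M − H_m`. [folklore] -/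
private theorem sum_Ioc_inv_eq (m M : ℕ) (h : m ≤ M) :
    ∑ b ∈ Finset.Ioc m M, (b : ℝ)⁻¹ = (harmonic M : ℝ) - (harmonic m : ℝ) := by
  have hI : ∀ n : ℕ, ∑ b ∈ Finset.Ioc 0 n, (b : ℝ)⁻¹ = (harmonic n : ℝ) := by
    intro n
    rw [harmonic_eq_sum_Icc, ← Finset.Icc_add_one_left_eq_Ioc]
    push_cast
    rfl
  have := Finset.sum_Ioc_consecutive (fun b : ℕ => (b : ℝ)⁻¹) (Nat.zero_le m) h
  rw [← hI M, ← hI m, ← this]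
  ring

/-- **Harmonic window**: for `0 < x ≤ y`, `Σ_{⌊x⌋ < b ≤ ⌊y⌋} 1/b ≤ 1 + log(y/x)`. [folklore] -/
private theorem sum_Ioc_floor_inv_le {x y : ℝ} (hx : 0 < x) (hxy : x ≤ y) :
    ∑ b ∈ Finset.Ioc ⌊x⌋₊ ⌊y⌋₊, (b : ℝ)⁻¹ ≤ 1 + Real.log (y / x) := by
  have hy : 0 < y := lt_of_lt_of_le hx hxy
  have hlog : 0 ≤ Real.log (y / x) := Real.log_nonneg ((one_le_div hx).2 hxy)
  rcases le_or_gt ⌊y⌋₊ ⌊x⌋₊ with h | h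
  · rw [Finset.Ioc_eq_empty (by omega), Finset.sum_empty]; linarith
  · have hM1 : 1 ≤ ⌊y⌋₊ := by omega
    have hM : (1 : ℝ) ≤ (⌊y⌋₊ : ℝ) := by exact_mod_cast hM1
    rw [sum_Ioc_inv_eq _ _ h.le]
    have h1 : (harmonic ⌊y⌋₊ : ℝ) ≤ 1 + Real.log (⌊y⌋₊ : ℝ) := harmonic_le_one_add_log _
    have h2 : Real.log ((⌊x⌋₊ + 1 : ℕ) : ℝ) ≤ (harmonic ⌊x⌋₊ : ℝ) := log_add_one_le_harmonic _
    have h3 : Real.log (⌊y⌋₊ : ℝ) ≤ Real.log y := Real.log_le_log (by linarith) (Nat.floor_le hy.le)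
    have h4 : Real.log x ≤ Real.log ((⌊x⌋₊ + 1 : ℕ) : ℝ) :=
      Real.log_le_log hx (by push_cast; exact (Nat.lt_floor_add_one x).le)
    rw [Real.log_div hy.ne' hx.ne']
    linarith

/-- `Σ_{b ≥ 0} r^b = (1 − r)^{-1} ≤ 1 + 1/c` for `r = e^{-c}`, `c > 0`. [folklore] -/
private theorem tsum_exp_pow_le {c : ℝ} (hc : 0 < c) :
    HasSum (fun b : ℕ => Real.exp (-c) ^ b) (1 - Real.exp (-c))⁻¹ ∧ (1 - Real.exp (-c))⁻¹ ≤ 1 + 1 / c := by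
  have hr0 : 0 ≤ Real.exp (-c) := (Real.exp_pos _).le
  have hr1 : Real.exp (-c) < 1 := Real.exp_lt_one_iff.2 (by linarith)
  refine ⟨hasSum_geometric_of_lt_one hr0 hr1, ?_⟩
  -- `1 − e^{-c} ≥ c/(1+c)`
  have hexp : Real.exp (-c) ≤ 1 / (1 + c) := by
    rw [Real.exp_neg, one_div]
    exact inv_anti₀ (by linarith) (by linarith [Real.add_one_le_exp c])
  have h1 : c / (1 + c) ≤ 1 - Real.exp (-c) := by
    have : 1 - 1 / (1 + c) = c / (1 + c) := by field_simp; ring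
    linarith
  have hpos : 0 < c / (1 + c) := by positivity
  calc (1 - Real.exp (-c))⁻¹ ≤ (c / (1 + c))⁻¹ := inv_anti₀ hpos h1
    _ = 1 + 1 / c := by field_simp; ring

/-- `Σ_{b ≥ 1} r^b = r(1 − r)^{-1} ≤ 2r` for `r = e^{-c}`, `c ≥ 1`. [folklore] -/
private theorem tsum_exp_pow_succ_le {c : ℝ} (hc : 1 ≤ c) :
    HasSum (fun b : ℕ => Real.exp (-c) ^ (b + 1)) (Real.exp (-c) * (1 - Real.exp (-c))⁻¹) ∧
      Real.exp (-c) * (1 - Real.exp (-c))⁻¹ ≤ 2 * Real.exp (-c) := by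
  have hr0 : 0 ≤ Real.exp (-c) := (Real.exp_pos _).le
  have hr1 : Real.exp (-c) < 1 := Real.exp_lt_one_iff.2 (by linarith)
  have h := (hasSum_geometric_of_lt_one hr0 hr1).mul_left (Real.exp (-c))
  refine ⟨by simpa [pow_succ'] using h, ?_⟩
  -- `e^{-c} ≤ e^{-1} ≤ 1/2`
  have hhalf : Real.exp (-c) ≤ 1 / 2 := by
    have h1 : Real.exp (-c) ≤ Real.exp (-1) := Real.exp_le_exp.2 (by linarith)
    have h2 : Real.exp (-1) ≤ 1 / 2 := by
      rw [Real.exp_neg, one_div]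
      exact inv_anti₀ (by norm_num) (by have := Real.exp_one_gt_d9; linarith)
    linarith
  have h3 : (1 - Real.exp (-c))⁻¹ ≤ 2 := by
    rw [show (2 : ℝ) = (1 / 2)⁻¹ by norm_num]
    exact inv_anti₀ (by norm_num) (by linarith)
  calc Real.exp (-c) * (1 - Real.exp (-c))⁻¹ ≤ Real.exp (-c) * 2 :=
        mul_le_mul_of_nonneg_left h3 hr0
    _ = 2 * Real.exp (-c) := by ring

end Harmonic

/-! ### §3. The inner sums `Σ_b w(ab)/b` -/

section Inner

variable {A B : ℝ}

/-- **Inner sum, `a ≤ B`**: `Σ_{b ≥ 1} w(ab)/b ≤ 4 + log(B/A)` for `1 ≤ A`, `4A ≤ B`, `1 ≤ a ≤ B`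
(ranges `b ≤ A/a`, `A/a < b ≤ B/a`, `b > B/a`). [cite: ConreyIwaniec2002, §6 (6.48)] -/
private theorem inner_le_of_le (hA : 1 ≤ A) (hAB : 4 * A ≤ B) {a : ℕ} (ha : 1 ≤ a) (haB : (a : ℝ) ≤ B) :
    Summable (fun b : ℕ =>
      (Real.exp (-((a : ℝ) * b / B)) - Real.exp (-((a : ℝ) * b / A))) / b) ∧
    ∑' b : ℕ, (Real.exp (-((a : ℝ) * b / B)) - Real.exp (-((a : ℝ) * b / A))) / b ≤
      4 + Real.log (B / A) := by
  have hA0 : 0 < A := by linarith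
  have hB0 : 0 < B := by linarith
  have hABle : A ≤ B := by linarith
  have ha0 : (0 : ℝ) < a := by exact_mod_cast ha
  set c : ℝ := (a : ℝ) / B with hc
  have hc0 : 0 < c := by positivity
  set f : ℕ → ℝ := fun b =>
    (Real.exp (-((a : ℝ) * b / B)) - Real.exp (-((a : ℝ) * b / A))) / b with hf
  -- the three majorants
  set g₁ : ℕ → ℝ := fun b => if b ∈ Finset.Icc 1 ⌊A / a⌋₊ then (a : ℝ) / A else 0 with hg₁
  set g₂ : ℕ → ℝ := fun b => if b ∈ Finset.Ioc ⌊A / a⌋₊ ⌊B / a⌋₊ then (b : ℝ)⁻¹ else 0 with hg₂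
  set g₃ : ℕ → ℝ := fun b => c * Real.exp (-c) ^ b with hg₃
  have hf0 : ∀ b, 0 ≤ f b := fun b => by
    simp only [hf]
    have hx : 0 ≤ (a : ℝ) * b := by positivity
    have := w_nonneg hA0 hABle hx
    rw [show (a : ℝ) * b / B = (a : ℝ) * b / B from rfl]
    positivity
  -- pointwise comparison `f ≤ g₁ + g₂ + g₃`
  have hle : ∀ b, f b ≤ g₁ b + g₂ b + g₃ b := by
    intro b
    have hg₁0 : 0 ≤ g₁ b := by simp only [hg₁]; split_ifs <;> positivity
    have hg₂0 : 0 ≤ g₂ b := by simp only [hg₂]; split_ifs <;> positivity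
    have hg₃0 : 0 ≤ g₃ b := by simp only [hg₃]; positivity
    rcases Nat.eq_zero_or_pos b with rfl | hb
    · simp only [hf, Nat.cast_zero, div_zero]; linarith
    have hb0 : (0 : ℝ) < b := by exact_mod_cast hb
    have hx : 0 ≤ (a : ℝ) * b := by positivity
    have hexpeq : Real.exp (-((a : ℝ) * b / B)) = Real.exp (-c) ^ b := by
      rw [← Real.exp_nat_mul, hc]; congr 1; ring
    by_cases h1 : (b : ℝ) ≤ A / a
    · -- range 1: `w(ab)/b ≤ (ab/A)/b = a/A = g₁ b`
      have hmem : b ∈ Finset.Icc 1 ⌊A / a⌋₊ :=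
        Finset.mem_Icc.2 ⟨hb, Nat.le_floor h1⟩
      have hw : Real.exp (-((a : ℝ) * b / B)) - Real.exp (-((a : ℝ) * b / A)) ≤ (a : ℝ) * b / A :=
        w_le_div hB0 hx
      have : f b ≤ g₁ b := by
        simp only [hf, hg₁, if_pos hmem]
        rw [div_le_iff₀ hb0]
        calc _ ≤ (a : ℝ) * b / A := hw
          _ = (a : ℝ) / A * b := by ring
      linarith
    by_cases h2 : (b : ℝ) ≤ B / a
    · -- range 2: `w(ab)/b ≤ 1/b = g₂ b`
      push Not at h1
      have hmem : b ∈ Finset.Ioc ⌊A / a⌋₊ ⌊B / a⌋₊ :=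
        Finset.mem_Ioc.2 ⟨(Nat.floor_lt (by positivity)).2 h1, Nat.le_floor h2⟩
      have hw := w_le_one (A := A) hB0 hx
      have : f b ≤ g₂ b := by
        simp only [hf, hg₂, if_pos hmem]
        rw [div_eq_mul_inv]
        exact mul_le_of_le_one_left (inv_nonneg.2 hb0.le) hw
      linarith
    · -- range 3: `w(ab)/b ≤ e^{-ab/B}/b ≤ c e^{-ab/B} = g₃ b` (`1/b < a/B = c`)
      push Not at h2
      have hbinv : (b : ℝ)⁻¹ ≤ c := by
        rw [hc, inv_eq_one_div, div_le_div_iff₀ hb0 hB0]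
        rw [div_lt_iff₀ ha0] at h2
        linarith
      have hw := w_le_exp (A := A) (B := B) (x := (a : ℝ) * b)
      have : f b ≤ g₃ b := by
        simp only [hf, hg₃]
        rw [div_eq_mul_inv, ← hexpeq]
        calc (Real.exp (-((a : ℝ) * b / B)) - Real.exp (-((a : ℝ) * b / A))) * (b : ℝ)⁻¹
            ≤ Real.exp (-((a : ℝ) * b / B)) * c :=
              mul_le_mul hw hbinv (inv_nonneg.2 hb0.le) (Real.exp_pos _).le
          _ = c * Real.exp (-((a : ℝ) * b / B)) := by ring
      linarith
  -- the three sums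
  have hAa : 0 < A / a := by positivity
  have hS₁ : Summable g₁ :=
    summable_of_ne_finset_zero (s := Finset.Icc 1 ⌊A / a⌋₊) (fun b hb => by simp only [hg₁, if_neg hb])
  have hT₁ : ∑' b, g₁ b ≤ 1 := by
    rw [tsum_eq_sum (s := Finset.Icc 1 ⌊A / a⌋₊) (fun b hb => by simp only [hg₁, if_neg hb])]
    rw [Finset.sum_congr rfl (fun b hb => by simp only [hg₁]; rw [if_pos hb]), Finset.sum_const,
      Nat.card_Icc, nsmul_eq_mul]
    have hfl : ((⌊A / a⌋₊ + 1 - 1 : ℕ) : ℝ) ≤ A / a := by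
      rw [Nat.add_sub_cancel]; exact Nat.floor_le hAa.le
    calc ((⌊A / a⌋₊ + 1 - 1 : ℕ) : ℝ) * ((a : ℝ) / A) ≤ (A / a) * ((a : ℝ) / A) :=
          mul_le_mul_of_nonneg_right hfl (by positivity)
      _ = 1 := by field_simp
  have hS₂ : Summable g₂ :=
    summable_of_ne_finset_zero (s := Finset.Ioc ⌊A / a⌋₊ ⌊B / a⌋₊)
      (fun b hb => by simp only [hg₂, if_neg hb])
  have hT₂ : ∑' b, g₂ b ≤ 1 + Real.log (B / A) := by
    rw [tsum_eq_sum (s := Finset.Ioc ⌊A / a⌋₊ ⌊B / a⌋₊) (fun b hb => by simp only [hg₂, if_neg hb])]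
    rw [Finset.sum_congr rfl (fun b hb => by simp only [hg₂]; rw [if_pos hb])]
    have h := sum_Ioc_floor_inv_le (x := A / a) (y := B / a) hAa
      (div_le_div_of_nonneg_right hABle ha0.le)
    have hBA : B / a / (A / a) = B / A := by field_simp
    rwa [hBA] at h
  obtain ⟨hgeom, hgeom_le⟩ := tsum_exp_pow_le hc0
  have hS₃ : Summable g₃ := (hgeom.mul_left c).summable
  have hT₃ : ∑' b, g₃ b ≤ 2 := by
    have hc1 : c ≤ 1 := by rw [hc, div_le_one hB0]; exact haB
    rw [(hgeom.mul_left c).tsum_eq]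
    calc c * (1 - Real.exp (-c))⁻¹ ≤ c * (1 + 1 / c) := mul_le_mul_of_nonneg_left hgeom_le hc0.le
      _ = c + 1 := by field_simp
      _ ≤ 2 := by linarith
  have hS : Summable fun b => g₁ b + g₂ b + g₃ b := (hS₁.add hS₂).add hS₃
  have hfS : Summable f := hS.of_nonneg_of_le hf0 hle
  refine ⟨hfS, ?_⟩
  calc ∑' b, f b ≤ ∑' b, (g₁ b + g₂ b + g₃ b) := hfS.tsum_le_tsum hle hS
    _ = ∑' b, g₁ b + ∑' b, g₂ b + ∑' b, g₃ b := by
        rw [(hS₁.add hS₂).tsum_add hS₃, hS₁.tsum_add hS₂]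
    _ ≤ 1 + (1 + Real.log (B / A)) + 2 := by gcongr
    _ = 4 + Real.log (B / A) := by ring

/-- **Inner sum, `a > B`**: `Σ_{b ≥ 1} w(ab)/b ≤ 2 e^{-a/B}` (`w(ab)/b ≤ e^{-ab/B}`, geometric series
with ratio `e^{-a/B} ≤ e^{-1}`). [cite: ConreyIwaniec2002, §6 (6.48)] -/
private theorem inner_le_of_gt (hA : 0 < A) (hAB : A ≤ B) {a : ℕ} (haB : B ≤ (a : ℝ)) :
    Summable (fun b : ℕ =>
      (Real.exp (-((a : ℝ) * b / B)) - Real.exp (-((a : ℝ) * b / A))) / b) ∧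
    ∑' b : ℕ, (Real.exp (-((a : ℝ) * b / B)) - Real.exp (-((a : ℝ) * b / A))) / b ≤
      2 * Real.exp (-((a : ℝ) / B)) := by
  have hB0 : 0 < B := lt_of_lt_of_le hA hAB
  have ha0 : (0 : ℝ) < a := lt_of_lt_of_le hB0 haB
  set c : ℝ := (a : ℝ) / B with hc
  have hc1 : 1 ≤ c := by rw [hc, le_div_iff₀ hB0]; linarith
  set f : ℕ → ℝ := fun b =>
    (Real.exp (-((a : ℝ) * b / B)) - Real.exp (-((a : ℝ) * b / A))) / b with hf
  set g : ℕ → ℝ := fun b => if b = 0 then 0 else Real.exp (-c) ^ b with hg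
  have hf0 : ∀ b, 0 ≤ f b := fun b => by
    simp only [hf]
    have hx : 0 ≤ (a : ℝ) * b := by positivity
    have := w_nonneg hA hAB hx
    positivity
  have hle : ∀ b, f b ≤ g b := by
    intro b
    rcases Nat.eq_zero_or_pos b with rfl | hb
    · simp [hf, hg]
    have hb0 : (0 : ℝ) < b := by exact_mod_cast hb
    have hb1 : (1 : ℝ) ≤ b := by exact_mod_cast hb
    have hexpeq : Real.exp (-((a : ℝ) * b / B)) = Real.exp (-c) ^ b := by
      rw [← Real.exp_nat_mul, hc]; congr 1; ring
    simp only [hf, hg, if_neg hb.ne']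
    rw [← hexpeq]
    have hw := w_le_exp (A := A) (B := B) (x := (a : ℝ) * b)
    have hE := Real.exp_pos (-((a : ℝ) * b / B))
    calc (Real.exp (-((a : ℝ) * b / B)) - Real.exp (-((a : ℝ) * b / A))) / b
        ≤ Real.exp (-((a : ℝ) * b / B)) / b := by gcongr
      _ ≤ Real.exp (-((a : ℝ) * b / B)) := div_le_self hE.le hb1
  obtain ⟨hgeom, hgeom_le⟩ := tsum_exp_pow_succ_le hc1
  have hg' : HasSum g (Real.exp (-c) * (1 - Real.exp (-c))⁻¹) := by
    have h0 : g 0 = 0 := by simp [hg]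
    have h1 : HasSum (fun b : ℕ => g (b + 1)) (Real.exp (-c) * (1 - Real.exp (-c))⁻¹) := by
      refine hgeom.congr_fun fun b => ?_
      simp [hg]
    have h2 := (hasSum_nat_add_iff 1).mp h1
    simpa [h0] using h2
  have hfS : Summable f := hg'.summable.of_nonneg_of_le hf0 hle
  refine ⟨hfS, ?_⟩
  calc ∑' b, f b ≤ ∑' b, g b := hfS.tsum_le_tsum hle hg'.summable
    _ = Real.exp (-c) * (1 - Real.exp (-c))⁻¹ := hg'.tsum_eq
    _ ≤ 2 * Real.exp (-c) := hgeom_le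

/-- **Uniform inner bound**: for `1 ≤ A`, `4A ≤ B`, `a ≥ 1`:
`Σ_{b ≥ 1} w(ab)/b ≤ e (4 + log(B/A)) e^{-a/B}`. [cite: ConreyIwaniec2002, §6 (6.48)] -/
private theorem inner_le (hA : 1 ≤ A) (hAB : 4 * A ≤ B) {a : ℕ} (ha : 1 ≤ a) :
    Summable (fun b : ℕ =>
      (Real.exp (-((a : ℝ) * b / B)) - Real.exp (-((a : ℝ) * b / A))) / b) ∧
    ∑' b : ℕ, (Real.exp (-((a : ℝ) * b / B)) - Real.exp (-((a : ℝ) * b / A))) / b ≤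
      Real.exp 1 * (4 + Real.log (B / A)) * Real.exp (-((a : ℝ) / B)) := by
  have hA0 : 0 < A := by linarith
  have hB0 : 0 < B := by linarith
  have hABle : A ≤ B := by linarith
  have hlog : 0 ≤ Real.log (B / A) := Real.log_nonneg (by rw [le_div_iff₀ hA0]; linarith)
  rcases le_or_gt (a : ℝ) B with haB | haB
  · obtain ⟨hS, hT⟩ := inner_le_of_le hA hAB ha haB
    refine ⟨hS, hT.trans ?_⟩
    -- `1 ≤ e · e^{-a/B}` since `a/B ≤ 1`
    have h1 : 1 ≤ Real.exp 1 * Real.exp (-((a : ℝ) / B)) := by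
      rw [← Real.exp_add]
      exact Real.one_le_exp (by have : (a : ℝ) / B ≤ 1 := (div_le_one hB0).2 haB; linarith)
    have h4 : 0 ≤ 4 + Real.log (B / A) := by linarith
    calc 4 + Real.log (B / A) = (4 + Real.log (B / A)) * 1 := (mul_one _).symm
      _ ≤ (4 + Real.log (B / A)) * (Real.exp 1 * Real.exp (-((a : ℝ) / B))) :=
          mul_le_mul_of_nonneg_left h1 h4
      _ = _ := by ring
  · obtain ⟨hS, hT⟩ := inner_le_of_gt hA0 hABle haB.le
    refine ⟨hS, hT.trans ?_⟩
    have he : (2 : ℝ) ≤ Real.exp 1 := by have := Real.exp_one_gt_d9; linarith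
    have hE := (Real.exp_pos (-((a : ℝ) / B))).le
    calc 2 * Real.exp (-((a : ℝ) / B)) ≤ Real.exp 1 * 4 * Real.exp (-((a : ℝ) / B)) := by nlinarith
      _ ≤ Real.exp 1 * (4 + Real.log (B / A)) * Real.exp (-((a : ℝ) / B)) := by
          gcongr; linarith

end Inner

/-! ### §4. Fubini over `ab = n` and the window bound -/

section Window

variable {A B : ℝ}

/-- The double series `F(a,b) = w(ab)/(ab)` is summable on `ℕ × ℕ` (dominated by
`(e^{-a/2B}/a)(e^{-b/2B}/b)`). [folklore] -/
private theorem summable_double (hA : 0 < A) (hAB : A ≤ B) :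
    Summable (fun p : ℕ × ℕ =>
      (Real.exp (-((p.1 : ℝ) * p.2 / B)) - Real.exp (-((p.1 : ℝ) * p.2 / A))) / ((p.1 : ℝ) * p.2)) := by
  have hB0 : 0 < B := lt_of_lt_of_le hA hAB
  -- the majorant `G(a,b) = (e^{-a/2B}/a)(e^{-b/2B}/b)`
  have hs : Summable fun n : ℕ => Real.exp (-(n / (2 * B))) / n := (hasSum_exp_div B hB0).summable
  have hsn : Summable fun n : ℕ => ‖Real.exp (-(n / (2 * B))) / n‖ := hs.norm
  have hG := summable_mul_of_summable_norm hsn hsn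
  refine hG.of_nonneg_of_le (fun p => ?_) (fun p => ?_)
  · have hx : 0 ≤ (p.1 : ℝ) * p.2 := by positivity
    have := w_nonneg hA hAB hx
    positivity
  · rcases Nat.eq_zero_or_pos p.1 with h1 | h1
    · simp [h1]
    rcases Nat.eq_zero_or_pos p.2 with h2 | h2
    · simp [h2]
    have hx : 0 ≤ (p.1 : ℝ) * p.2 := by positivity
    have hw := w_le_exp (A := A) (B := B) (x := (p.1 : ℝ) * p.2)
    have hhalf := exp_le_exp_half h1 h2 hB0
    have hab0 : (0 : ℝ) < (p.1 : ℝ) * p.2 := by positivity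
    calc (Real.exp (-((p.1 : ℝ) * p.2 / B)) - Real.exp (-((p.1 : ℝ) * p.2 / A))) / ((p.1 : ℝ) * p.2)
        ≤ Real.exp (-((p.1 : ℝ) * p.2 / B)) / ((p.1 : ℝ) * p.2) := by gcongr
      _ = Real.exp (-(((p.1 * p.2 : ℕ) : ℝ) / B)) / ((p.1 : ℝ) * p.2) := by push_cast; rfl
      _ ≤ (Real.exp (-(p.1 / (2 * B))) * Real.exp (-(p.2 / (2 * B)))) / ((p.1 : ℝ) * p.2) := by
          gcongr
      _ = Real.exp (-(p.1 / (2 * B))) / p.1 * (Real.exp (-(p.2 / (2 * B))) / p.2) := by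
          field_simp

/-- **Fubini over `ab = n`**: `Σ_n d(n) w(n)/n = Σ_a Σ_b w(ab)/(ab)`. [folklore] -/
private theorem tsum_divisor_eq_tsum_tsum (hA : 0 < A) (hAB : A ≤ B) :
    ∑' n : ℕ, (n.divisors.card : ℝ) * (Real.exp (-(n / B)) - Real.exp (-(n / A))) / n =
      ∑' a : ℕ, ∑' b : ℕ,
        (Real.exp (-((a : ℝ) * b / B)) - Real.exp (-((a : ℝ) * b / A))) / ((a : ℝ) * b) := by
  set F : ℕ × ℕ → ℝ := fun p =>
    (Real.exp (-((p.1 : ℝ) * p.2 / B)) - Real.exp (-((p.1 : ℝ) * p.2 / A))) / ((p.1 : ℝ) * p.2) with hF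
  have hFs : Summable F := summable_double hA hAB
  -- fibers of `(a, b) ↦ ab`
  have hfib := hFs.hasSum.tsum_fiberwise (fun p : ℕ × ℕ => p.1 * p.2)
  have hfiber : ∀ n : ℕ, ∑' p : ((fun p : ℕ × ℕ => p.1 * p.2) ⁻¹' {n}), F p.val =
      (n.divisors.card : ℝ) * (Real.exp (-(n / B)) - Real.exp (-(n / A))) / n := by
    intro n
    rcases eq_or_ne n 0 with rfl | hn
    · have : ∀ p : ((fun p : ℕ × ℕ => p.1 * p.2) ⁻¹' {0}), F p.val = 0 := by
        rintro ⟨⟨a, b⟩, hp⟩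
        have hp' : a * b = 0 := by simpa using hp
        simp only [hF]
        have : (a : ℝ) * b = 0 := by exact_mod_cast hp'
        rw [this]; simp
      simp [this]
    rw [show (fun p : ℕ × ℕ => p.1 * p.2) ⁻¹' {n} = n.divisorsAntidiagonal by ext; simp [hn],
      Finset.tsum_subtype' n.divisorsAntidiagonal F]
    have hterm : ∀ p ∈ n.divisorsAntidiagonal, F p = (Real.exp (-(n / B)) - Real.exp (-(n / A))) / n := by
      intro p hp
      have hp' := (Nat.mem_divisorsAntidiagonal.1 hp).1
      simp only [hF]
      have : (p.1 : ℝ) * p.2 = n := by exact_mod_cast hp'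
      rw [this]
    rw [Finset.sum_congr rfl hterm, Finset.sum_const, nsmul_eq_mul, ← Nat.map_div_right_divisors,
      Finset.card_map]
    ring
  have h1 : HasSum (fun n : ℕ => (n.divisors.card : ℝ) * (Real.exp (-(n / B)) - Real.exp (-(n / A))) / n)
      (∑' p, F p) := by
    refine hfib.congr_fun fun n => (hfiber n).symm
  rw [h1.tsum_eq, hFs.tsum_prod' (fun a => hFs.prod_factor a)]

/-- **The divisor log-window** (stub S1 of SKELETON I6c, registered signature): for `1 ≤ A`,
`4A ≤ B`, `‖W_d(B) − W_d(A)‖ ≤ C (1 + log B) log(B/A)` with `C = 12`.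
[cite: ConreyIwaniec2002, §6 (6.48)–(6.49)] -/
theorem norm_W_dCoeff_window_le :
    ∃ C : ℝ, 0 < C ∧ ∀ A B : ℝ, 1 ≤ A → 4 * A ≤ B →
      ‖W dCoeff B - W dCoeff A‖ ≤ C * (1 + Real.log B) * Real.log (B / A) := by
  refine ⟨12, by norm_num, fun A B hA hAB => ?_⟩
  have hA0 : 0 < A := by linarith
  have hB0 : 0 < B := by linarith
  have hB4 : 4 ≤ B := by linarith
  have hABle : A ≤ B := by linarith
  have hlog4 : Real.log 4 ≤ Real.log (B / A) :=
    Real.log_le_log (by norm_num) (by rw [le_div_iff₀ hA0]; linarith)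
  have hl4 : (1.2 : ℝ) ≤ Real.log 4 := by
    rw [show (4 : ℝ) = 2 ^ 2 by norm_num, Real.log_pow]; have := Real.log_two_gt_d9; push_cast; linarith
  have hlogBA : 1.2 ≤ Real.log (B / A) := hl4.trans hlog4
  have hlogB : 0 ≤ Real.log B := Real.log_nonneg (by linarith)
  -- the real series
  set t : ℕ → ℝ := fun n => (n.divisors.card : ℝ) * (Real.exp (-(n / B)) - Real.exp (-(n / A))) / n
    with ht
  have hdc : dCoeff = fun n => ((n.divisors.card : ℝ) : ℂ) := by
    funext n; rw [dCoeff_apply]; push_cast; rfl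
  have hsB := summable_mul_exp_div (a := fun n => (n.divisors.card : ℝ)) (C := 1)
    (fun n => by rw [Nat.abs_cast, one_mul]; exact_mod_cast Nat.card_divisors_le_self n) hB0
  have hsA := summable_mul_exp_div (a := fun n => (n.divisors.card : ℝ)) (C := 1)
    (fun n => by rw [Nat.abs_cast, one_mul]; exact_mod_cast Nat.card_divisors_le_self n) hA0
  have hdiff : W dCoeff B - W dCoeff A = ((∑' n, t n : ℝ) : ℂ) := by
    rw [hdc, W_ofReal, W_ofReal, ← Complex.ofReal_sub, ← hsB.tsum_sub hsA]
    congr 1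
    refine tsum_congr fun n => ?_
    simp only [ht]; ring
  have ht0 : ∀ n, 0 ≤ t n := fun n => by
    simp only [ht]
    have := w_nonneg hA0 hABle (Nat.cast_nonneg n)
    positivity
  rw [hdiff, Complex.norm_real, Real.norm_of_nonneg (tsum_nonneg ht0)]
  -- Fubini and the inner/outer bounds
  rw [show (∑' n, t n) = _ from tsum_divisor_eq_tsum_tsum hA0 hABle]
  set K : ℝ := Real.exp 1 * (4 + Real.log (B / A)) with hK
  have hK0 : 0 ≤ K := by
    rw [hK]; exact mul_nonneg (Real.exp_pos 1).le (by linarith)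
  -- inner bound: `Σ_b F(a,b) ≤ K e^{-a/B}/a`
  have hinner : ∀ a : ℕ, ∑' b : ℕ,
      (Real.exp (-((a : ℝ) * b / B)) - Real.exp (-((a : ℝ) * b / A))) / ((a : ℝ) * b) ≤
      K * (Real.exp (-(a / (2 * (B / 2)))) / a) := by
    intro a
    rcases Nat.eq_zero_or_pos a with rfl | ha
    · simp
    have ha0 : (0 : ℝ) < a := by exact_mod_cast ha
    obtain ⟨hS, hT⟩ := inner_le hA hAB ha
    have heq : (fun b : ℕ =>
        (Real.exp (-((a : ℝ) * b / B)) - Real.exp (-((a : ℝ) * b / A))) / ((a : ℝ) * b)) =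
        fun b : ℕ => (a : ℝ)⁻¹ *
          ((Real.exp (-((a : ℝ) * b / B)) - Real.exp (-((a : ℝ) * b / A))) / b) := by
      funext b; rw [div_mul_eq_div_div, div_eq_inv_mul, div_eq_mul_inv, div_eq_mul_inv]; ring
    rw [heq, tsum_mul_left, show (2 * (B / 2)) = B by ring]
    calc (a : ℝ)⁻¹ * ∑' b : ℕ, (Real.exp (-((a : ℝ) * b / B)) - Real.exp (-((a : ℝ) * b / A))) / b
        ≤ (a : ℝ)⁻¹ * (K * Real.exp (-((a : ℝ) / B))) := by
          rw [hK]; exact mul_le_mul_of_nonneg_left hT (inv_nonneg.2 ha0.le)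
      _ = K * (Real.exp (-(a / B)) / a) := by rw [div_eq_mul_inv]; ring
  have hFs : Summable (fun p : ℕ × ℕ =>
      (Real.exp (-((p.1 : ℝ) * p.2 / B)) - Real.exp (-((p.1 : ℝ) * p.2 / A))) / ((p.1 : ℝ) * p.2)) :=
    summable_double hA0 hABle
  have houter := hasSum_exp_div (B / 2) (by positivity)
  have hSh : Shalf (B / 2) ≤ 1 + Real.log B := by
    have h := Shalf_le (Y := B / 2) (by positivity)
    rw [show 2 * (B / 2) = B by ring] at h
    have : Real.log (1 + B) ≤ 1 + Real.log B := by
      have h2 : 1 + B ≤ Real.exp 1 * B := by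
        have := Real.add_one_le_exp (1 : ℝ); nlinarith
      calc Real.log (1 + B) ≤ Real.log (Real.exp 1 * B) := Real.log_le_log (by linarith) h2
        _ = 1 + Real.log B := by rw [Real.log_mul (Real.exp_pos 1).ne' hB0.ne', Real.log_exp]
    linarith
  calc ∑' a : ℕ, ∑' b : ℕ,
        (Real.exp (-((a : ℝ) * b / B)) - Real.exp (-((a : ℝ) * b / A))) / ((a : ℝ) * b)
      ≤ ∑' a : ℕ, K * (Real.exp (-(a / (2 * (B / 2)))) / a) :=
        hFs.prod.tsum_le_tsum hinner (houter.summable.mul_left K)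
    _ = K * Shalf (B / 2) := by rw [tsum_mul_left, houter.tsum_eq]
    _ ≤ K * (1 + Real.log B) := mul_le_mul_of_nonneg_left hSh hK0
    _ = Real.exp 1 * (4 + Real.log (B / A)) * (1 + Real.log B) := by rw [hK]
    _ ≤ 12 * (1 + Real.log B) * Real.log (B / A) := by
        -- `e ≤ 2.72`, `4 + L ≤ (4/1.2 + 1) L ≤ 4.34 L`, `2.72 · 4.34 ≤ 12`
        have he : Real.exp 1 ≤ 2.72 := by have := Real.exp_one_lt_d9; linarith
        have h1 : 0 ≤ 1 + Real.log B := by linarith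
        have h4 : 4 + Real.log (B / A) ≤ 4.4 * Real.log (B / A) := by linarith
        calc Real.exp 1 * (4 + Real.log (B / A)) * (1 + Real.log B)
            ≤ 2.72 * (4.4 * Real.log (B / A)) * (1 + Real.log B) := by
              gcongr
          _ ≤ 12 * (1 + Real.log B) * Real.log (B / A) := by nlinarith

end Window

end Literature.NumberTheory.LFunctions.DivisorSumCharSq

end
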